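import Summits.ResolutionOfSingularities.ResolutionOfSingularities.Theorems.ValuativeLuAlphaPTorsorAdaptedValueStepExpansion
import Mathlib.RingTheory.Adjoin.FG
import HarnessLib

/-!
# Adapted value step, III: values of a flag-adapted chart are monomial values

Crux `Valuative.LuAlphaPTorsor` (stmt-ResolutionOfSingularities-0641), line `pfaff-line-log-final-forms`,
registered stub `stub_adaptedValueStep` (F6v, wave 2: the ADAPTED value step of the purely
inseparable tower, any rank) — helper file 3/8.

`adValue_claimC`: on a flag-adapted chart (clauses (C2a), (C3) and `LevelArchimedean`), an
element `r ∈ R` which is not smaller than every Laurent monomial of the levels `< ℓ` has the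
value of a monomial `x^m`, `m ∈ ℕⁿ` supported on the levels `< ℓ` (induction on `ℓ`: relative
expansion at level `ℓ` to the depth given by the lattice-archimedean bound
`adValue_depth_bound`, dominant term). Also: elements of `R[y]` are polynomials in `y` over `R`,
a normal form for `R₁[y_j / y^(D j) : lv' j < ℓ]`, and the finitely generated ideal of small
elements of a finitely generated subalgebra of `O` (Hilbert). Builds on helper files I–II. [folklore]
-/

noncomputable section

-- `Summit.<S>.<S>.…` duplicates the summit name by design (D-0017, single-problem summit).
set_option linter.dupNamespace false

open IsLocalRing

namespace Summit.ResolutionOfSingularities.ResolutionOfSingularities.Theorems.PfaffLine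

open Literature.AlgebraicGeometry.Resolution

section ClaimC

variable {k K : Type} [Field k] [Field K] [Algebra k K] (O : ValuationSubring K) {n : ℕ}
  (R : Subalgebra k K) (hRO : R.toSubring ≤ O.toSubring) (x : Fin n → K) (hx : ∀ i, x i ∈ R)
  (lv : Fin n → ℕ)

variable (hx0 : ∀ i, x i ≠ 0)
  (hC2a : ∀ i i', lv i < lv i' → ∀ m : Fin n → ℤ, (∀ j, lv i < lv j → m j = 0) →
    O.valuation (x i') < ∏ j, O.valuation (x j) ^ (m j))
  (hC3 : ∀ (ℓ : ℕ) (z : R.toSubring),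
    z ∈ Ideal.span (Set.range fun i : {i : Fin n // ℓ ≤ lv i} => (⟨x i.1, hx i.1⟩ : R.toSubring)) ↔
      ∀ m : Fin n → ℤ, (∀ j, ℓ ≤ lv j → m j = 0) →
        O.valuation (z : K) < ∏ j, O.valuation (x j) ^ (m j))

include hx0 hC2a hC3 in
/-- **Depth bound at level `ℓ`** (lattice-archimedean levels): monomials in the parameters of
level `ℓ` of large degree are smaller than a given Laurent monomial of the levels `≤ ℓ`. -/
theorem adValue_depth_bound (hLA : LevelArchimedean (fun i => O.valuation (x i)) lv) (ℓ : ℕ)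
    (hℓ : ∃ i, lv i = ℓ) (ms : Fin n → ℤ) (hms : ∀ j, ℓ < lv j → ms j = 0) :
    ∃ N : ℕ, ∀ μ : Fin n →₀ ℕ, (∀ j, lv j ≠ ℓ → μ j = 0) → N ≤ Finsupp.degree μ →
      (∏ j, O.valuation (x j) ^ (μ j)) < ∏ j, O.valuation (x j) ^ (ms j) := by
  classical
  have hv0 : ∀ j, O.valuation (x j) ≠ 0 := fun j => (map_ne_zero _).mpr (hx0 j)
  have hlt1 := adValue_param_lt_one O R x hx lv hC3
  -- one exponent per parameter of level `ℓ`
  have key : ∀ i, ∃ Ni : ℕ, lv i = ℓ →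
      O.valuation (x i) ^ (Ni + 1) < ∏ j, O.valuation (x j) ^ (ms j) := by
    intro i
    by_cases hi : lv i = ℓ
    swap
    · exact ⟨0, fun h => (hi h).elim⟩
    let μ' : Fin n → ℤ := fun j => if lv j = ℓ then ms j else 0
    let ml : Fin n → ℤ := fun j => if lv j = ℓ then 0 else ms j
    have hsingle : (∏ j, O.valuation (x j) ^ ((Pi.single i 1 : Fin n → ℤ) j)) =
        O.valuation (x i) := by
      rw [Finset.prod_eq_single i (fun j _ hj => by rw [Pi.single_eq_of_ne hj, zpow_zero])
        (fun h => absurd (Finset.mem_univ i) h), Pi.single_eq_same, zpow_one]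
    obtain ⟨N, hN⟩ := hLA ℓ (Pi.single i 1) μ' (fun j hj => by
        rw [Pi.single_eq_of_ne (fun h => hj (by rw [h]; exact hi))])
      (fun j hj => by simp only [μ', if_neg hj]) (fun m hm => by
        rw [hsingle]
        exact adValue_param_small O R x hx lv hC2a hC3 ℓ i hi.ge m hm)
    rw [hsingle] at hN
    refine ⟨N, fun _ => ?_⟩
    have hml : O.valuation (x i) < ∏ j, O.valuation (x j) ^ (ml j) :=
      adValue_param_small O R x hx lv hC2a hC3 ℓ i hi.ge ml fun j hj => by
        by_cases hj' : lv j = ℓ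
        · simp only [ml, if_pos hj']
        · simp only [ml, if_neg hj', hms j (lt_of_le_of_ne hj (Ne.symm hj'))]
    have hprod : (∏ j, O.valuation (x j) ^ (μ' j)) * ∏ j, O.valuation (x j) ^ (ml j) =
        ∏ j, O.valuation (x j) ^ (ms j) := by
      rw [← Finset.prod_mul_distrib]
      refine Finset.prod_congr rfl fun j _ => ?_
      rw [← zpow_add₀ (hv0 j)]
      congr 1
      by_cases hj : lv j = ℓ <;> simp [μ', ml, hj]
    rw [pow_succ, ← hprod]
    exact mul_lt_mul'' hN hml zero_le zero_le
  choose Nf hNf using key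
  refine ⟨∑ i, (Nf i + 1), fun μ hμ hdeg => ?_⟩
  -- pigeonhole: some parameter of level `ℓ` occurs with exponent `> Nf i`
  have hex : ∃ i, lv i = ℓ ∧ Nf i + 1 ≤ μ i := by
    by_contra hno
    push Not at hno
    have hle : ∀ i, μ i ≤ Nf i := fun i => by
      by_cases hi : lv i = ℓ
      · exact Nat.lt_succ_iff.mp (hno i hi)
      · rw [hμ i hi]; exact Nat.zero_le _
    obtain ⟨i₀, hi₀⟩ := hℓ
    have hlt : Finsupp.degree μ < ∑ i, (Nf i + 1) := by
      rw [Finsupp.degree_eq_sum]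
      exact Finset.sum_lt_sum_of_nonempty ⟨i₀, Finset.mem_univ _⟩
        fun i _ => Nat.lt_succ_of_le (hle i)
    omega
  obtain ⟨i, hi, hNi⟩ := hex
  calc (∏ j, O.valuation (x j) ^ (μ j)) ≤ O.valuation (x i) ^ (μ i) := by
        rw [← Finset.mul_prod_erase Finset.univ _ (Finset.mem_univ i)]
        exact mul_le_of_le_one_right' (Finset.prod_le_one' fun j _ => pow_le_one' (hlt1 j).le _)
    _ ≤ O.valuation (x i) ^ (Nf i + 1) := pow_le_pow_right_of_le_one' (hlt1 i).le hNi
    _ < ∏ j, O.valuation (x j) ^ (ms j) := hNf i hi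

include hRO hx0 hC2a hC3 in
/-- **Values of an adapted chart are monomial values, level by level.** If `r ∈ R` is not
smaller than every Laurent monomial of the levels `< ℓ` (equivalently, `r ∉ (xᵢ : lv i ≥ ℓ)`),
then `v(r) = v(x^m)` for some `m ∈ ℕⁿ` supported on the levels `< ℓ`. -/
theorem adValue_claimC (hind : ∀ m : Fin n → ℤ, (∏ i, O.valuation (x i) ^ (m i)) = 1 → m = 0)
    (hLA : LevelArchimedean (fun i => O.valuation (x i)) lv) :
    ∀ (ℓ : ℕ) (r : K), r ∈ R →
      (∃ m : Fin n → ℤ, (∀ j, ℓ ≤ lv j → m j = 0) ∧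
        (∏ j, O.valuation (x j) ^ (m j)) ≤ O.valuation r) →
      ∃ m : Fin n → ℕ, (∀ j, ℓ ≤ lv j → m j = 0) ∧
        O.valuation r = ∏ j, O.valuation (x j) ^ (m j) := by
  classical
  have hv0 : ∀ j, O.valuation (x j) ≠ 0 := fun j => (map_ne_zero _).mpr (hx0 j)
  have hv0' : ∀ m : Fin n → ℤ, (∏ j, O.valuation (x j) ^ (m j)) ≠ 0 := fun m =>
    Finset.prod_ne_zero_iff.mpr fun j _ => zpow_ne_zero _ (hv0 j)
  intro ℓ
  induction ℓ with
  | zero =>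
    rintro r hr ⟨m, hm, hle⟩
    have hm0 : ∀ j, m j = 0 := fun j => hm j (Nat.zero_le _)
    simp only [hm0, zpow_zero, Finset.prod_const_one] at hle
    refine ⟨0, fun _ _ => rfl, ?_⟩
    simp only [Pi.zero_apply, pow_zero, Finset.prod_const_one]
    exact le_antisymm ((O.valuation_le_one_iff _).mpr (hRO hr)) hle
  | succ ℓ ih =>
    rintro r hr ⟨ms, hms, hle⟩
    by_cases hbig : ∃ m : Fin n → ℤ, (∀ j, ℓ ≤ lv j → m j = 0) ∧
        (∏ j, O.valuation (x j) ^ (m j)) ≤ O.valuation r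
    · obtain ⟨m, hm, h⟩ := ih r hr hbig
      exact ⟨m, fun j hj => hm j (Nat.le_of_succ_le hj), h⟩
    push Not at hbig
    by_cases hℓ : ∃ i, lv i = ℓ
    swap
    · exfalso
      push Not at hℓ
      refine absurd hle (not_le.mpr (hbig ms fun j hj => hms j ?_))
      exact Nat.succ_le_of_lt (lt_of_le_of_ne hj (fun h => hℓ j h.symm))
    have hms' : ∀ j, ℓ < lv j → ms j = 0 := fun j hj => hms j hj
    obtain ⟨N, hN⟩ := adValue_depth_bound O R x hx lv hx0 hC2a hC3 hLA ℓ hℓ ms hms'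
    obtain ⟨P, hPR, hPs, hPv, hPe⟩ := adValue_rel_expansion O R hRO x hx lv hx0 hC2a hC3 ℓ N hr
    -- the terms of the expansion
    set f : (Fin n →₀ ℕ) → K := fun μ => P.coeff μ * ∏ j, x j ^ (μ j) with hf
    set F₁ := P.support.filter fun μ => Finsupp.degree μ < N with hF₁
    set F₂ := P.support.filter fun μ => ¬ Finsupp.degree μ < N with hF₂
    have hsplit : r = (∑ μ ∈ F₁, f μ) + ((∑ μ ∈ F₂, f μ) + (r - MvPolynomial.eval x P)) := by
      rw [← add_assoc, Finset.sum_filter_add_sum_filter_not, ← MvPolynomial.eval_eq']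
      ring
    -- the small part
    have hB : O.valuation ((∑ μ ∈ F₂, f μ) + (r - MvPolynomial.eval x P)) < O.valuation r := by
      refine Valuation.map_add_lt _ (Valuation.map_sum_lt _ ?_ fun μ hμ => ?_)
        ((hPe ms hms').trans_le hle)
      · exact fun h => (hv0' ms) (le_zero_iff.mp (h ▸ hle))
      obtain ⟨hμs, hμd⟩ := Finset.mem_filter.mp hμ
      calc O.valuation (f μ) ≤ O.valuation (∏ j, x j ^ (μ j)) := by
            rw [hf, map_mul]
            exact mul_le_of_le_one_left' ((O.valuation_le_one_iff _).mpr (hRO (hPR μ)))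
        _ = ∏ j, O.valuation (x j) ^ (μ j) := valuation_prod_pow O x _
        _ < ∏ j, O.valuation (x j) ^ (ms j) := hN μ (hPs μ hμs) (not_lt.mp hμd)
        _ ≤ O.valuation r := hle
    -- the values of the big part
    have hval : ∀ μ, ∃ m : Fin n → ℕ, μ ∈ F₁ → (∀ j, ℓ ≤ lv j → m j = 0) ∧
        O.valuation (P.coeff μ) = ∏ j, O.valuation (x j) ^ (m j) := fun μ => by
      by_cases hμ : μ ∈ F₁
      · obtain ⟨hμs, hμd⟩ := Finset.mem_filter.mp hμ
        obtain ⟨m, hm, h⟩ := ih _ (hPR μ) (hPv μ hμs hμd)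
        exact ⟨m, fun _ => ⟨hm, h⟩⟩
      · exact ⟨0, fun h => (hμ h).elim⟩
    choose mf hmf using hval
    have hvf : ∀ μ ∈ F₁, O.valuation (f μ) = ∏ j, O.valuation (x j) ^ (mf μ j + μ j) := by
      intro μ hμ
      rw [hf, map_mul, (hmf μ hμ).2, valuation_prod_pow O x, ← Finset.prod_mul_distrib]
      exact Finset.prod_congr rfl fun j _ => (pow_add _ _ _).symm
    have hinj : ∀ μ ∈ F₁, ∀ μ' ∈ F₁, O.valuation (f μ) = O.valuation (f μ') → μ = μ' := by
      intro μ hμ μ' hμ' h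
      rw [hvf μ hμ, hvf μ' hμ'] at h
      have h' : (∏ j, O.valuation (x j) ^ ((fun j => ((mf μ j + μ j : ℕ) : ℤ)) j)) =
          ∏ j, O.valuation (x j) ^ ((fun j => ((mf μ' j + μ' j : ℕ) : ℤ)) j) := by
        simpa only [zpow_natCast] using h
      have heq := eq_of_prod_zpow_eq O x hx0 hind _ _ h'
      ext j
      have hj := congrFun heq j
      simp only [Nat.cast_inj] at hj
      by_cases hjℓ : lv j = ℓ
      · rw [(hmf μ hμ).1 j hjℓ.ge, (hmf μ' hμ').1 j hjℓ.ge] at hj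
        simpa using hj
      · rw [hPs μ (Finset.mem_filter.mp hμ).1 j hjℓ, hPs μ' (Finset.mem_filter.mp hμ').1 j hjℓ]
    -- `F₁` is non-empty
    rcases F₁.eq_empty_or_nonempty with hF₁0 | hF₁ne
    · exfalso
      rw [hF₁0, Finset.sum_empty, zero_add] at hsplit
      rw [← hsplit] at hB
      exact lt_irrefl _ hB
    obtain ⟨μ₀, hμ₀, hmax⟩ := Finset.exists_max_image F₁ (fun μ => O.valuation (f μ)) hF₁ne
    have hA : O.valuation (∑ μ ∈ F₁, f μ) = O.valuation (f μ₀) := by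
      refine Valuation.map_sum_eq_of_lt _ hμ₀ fun μ hμ => ?_
      rw [Finset.mem_sdiff, Finset.mem_singleton] at hμ
      exact lt_of_le_of_ne (hmax μ hμ.1) fun h => hμ.2 (hinj μ hμ.1 μ₀ hμ₀ h)
    refine ⟨fun j => mf μ₀ j + μ₀ j, fun j hj => ?_, ?_⟩
    · change mf μ₀ j + μ₀ j = 0
      rw [(hmf μ₀ hμ₀).1 j (Nat.le_of_succ_le hj),
        hPs μ₀ (Finset.mem_filter.mp hμ₀).1 j (by omega)]
    · rw [← hvf μ₀ hμ₀, ← hA]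
      set A := ∑ μ ∈ F₁, f μ
      set B := (∑ μ ∈ F₂, f μ) + (r - MvPolynomial.eval x P)
      rcases lt_trichotomy (O.valuation A) (O.valuation r) with hlt | heq | hgt
      · exfalso
        have h := Valuation.map_add_lt O.valuation hlt hB
        rw [← hsplit] at h
        exact lt_irrefl _ h
      · exact heq.symm
      · have h := Valuation.map_add_eq_of_lt_left O.valuation (hB.trans hgt)
        rw [← hsplit] at h
        exact h

end ClaimC

section Recursion

variable {k K : Type} [Field k] [Field K] [Algebra k K] (O : ValuationSubring K) {n : ℕ}

/-- Elements of `R[y]` are polynomials in `y` with coefficients in `R`. -/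
theorem adValue_poly_of_mem (R : Subalgebra k K) (y : Fin n → K) {z : K}
    (hz : z ∈ Algebra.adjoin k ((R : Set K) ∪ Set.range y)) :
    ∃ P : MvPolynomial (Fin n) K, (∀ μ, P.coeff μ ∈ R) ∧ MvPolynomial.eval y P = z := by
  classical
  induction hz using Algebra.adjoin_induction with
  | mem w hw =>
    rcases hw with hw | ⟨j, rfl⟩
    · refine ⟨MvPolynomial.C w, fun μ => ?_, MvPolynomial.eval_C _⟩
      rw [MvPolynomial.coeff_C]
      split_ifs
      exacts [hw, R.zero_mem]
    · refine ⟨MvPolynomial.X j, fun μ => ?_, MvPolynomial.eval_X _⟩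
      rw [MvPolynomial.coeff_X]
      split_ifs
      exacts [R.one_mem, R.zero_mem]
  | algebraMap c =>
    refine ⟨MvPolynomial.C (algebraMap k K c), fun μ => ?_, MvPolynomial.eval_C _⟩
    rw [MvPolynomial.coeff_C]
    split_ifs
    exacts [R.algebraMap_mem c, R.zero_mem]
  | add w₁ w₂ _ _ ih₁ ih₂ =>
    obtain ⟨P₁, hP₁, h₁⟩ := ih₁
    obtain ⟨P₂, hP₂, h₂⟩ := ih₂
    exact ⟨P₁ + P₂, fun μ => by rw [MvPolynomial.coeff_add]; exact R.add_mem (hP₁ μ) (hP₂ μ),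
      by rw [map_add, h₁, h₂]⟩
  | mul w₁ w₂ _ _ ih₁ ih₂ =>
    obtain ⟨P₁, hP₁, h₁⟩ := ih₁
    obtain ⟨P₂, hP₂, h₂⟩ := ih₂
    refine ⟨P₁ * P₂, fun μ => ?_, by rw [map_mul, h₁, h₂]⟩
    rw [MvPolynomial.coeff_mul]
    exact R.sum_mem fun a _ => R.mul_mem (hP₁ _) (hP₂ _)

variable (R₁ : Subalgebra k K) (y : Fin n → K) (lv' : Fin n → ℕ) (hy0 : ∀ j, y j ≠ 0)
  (hyR₁ : ∀ j, y j ∈ R₁)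

include hy0 hyR₁ in
/-- **Normal form below level `ℓ`**: an element of `R₁[y_j / y^{D j} : lv' j < ℓ]` (with `D j`
supported on the levels `< lv' j`) becomes an element of `R₁` after multiplication by a monomial
in the `y_j` of level `< ℓ`. -/
theorem adValue_normal_form (D : Fin n → Fin n → ℕ) (hD : ∀ j i, lv' j ≤ lv' i → D j i = 0)
    (ℓ : ℕ) {z : K} (hz : z ∈ Algebra.adjoin k ((R₁ : Set K) ∪
      ((fun j => y j * (∏ i, y i ^ (D j i))⁻¹) '' {j | lv' j < ℓ}))) :
    ∃ g : Fin n → ℕ, (∀ j, ℓ ≤ lv' j → g j = 0) ∧ (∏ j, y j ^ (g j)) * z ∈ R₁ := by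
  classical
  induction hz using Algebra.adjoin_induction with
  | mem w hw =>
    rcases hw with hw | ⟨j, hj, rfl⟩
    · exact ⟨0, fun _ _ => rfl, by simpa using hw⟩
    · refine ⟨D j, fun i hi => hD j i (le_of_lt (lt_of_lt_of_le hj hi)), ?_⟩
      rw [mul_left_comm, mul_inv_cancel₀ (Finset.prod_ne_zero_iff.mpr fun i _ =>
        pow_ne_zero _ (hy0 i)), mul_one]
      exact hyR₁ j
  | algebraMap c => exact ⟨0, fun _ _ => rfl, by simp [R₁.algebraMap_mem c]⟩
  | add w₁ w₂ _ _ ih₁ ih₂ =>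
    obtain ⟨g₁, hg₁, h₁⟩ := ih₁
    obtain ⟨g₂, hg₂, h₂⟩ := ih₂
    refine ⟨g₁ + g₂, fun j hj => by rw [Pi.add_apply, hg₁ j hj, hg₂ j hj], ?_⟩
    have heq : (∏ j, y j ^ ((g₁ + g₂) j)) * (w₁ + w₂) =
        (∏ j, y j ^ (g₂ j)) * ((∏ j, y j ^ (g₁ j)) * w₁) +
          (∏ j, y j ^ (g₁ j)) * ((∏ j, y j ^ (g₂ j)) * w₂) := by
      simp only [Pi.add_apply, pow_add, Finset.prod_mul_distrib]
      ring
    rw [heq]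
    exact R₁.add_mem (R₁.mul_mem (R₁.prod_mem fun j _ => R₁.pow_mem (hyR₁ j) _) h₁)
      (R₁.mul_mem (R₁.prod_mem fun j _ => R₁.pow_mem (hyR₁ j) _) h₂)
  | mul w₁ w₂ _ _ ih₁ ih₂ =>
    obtain ⟨g₁, hg₁, h₁⟩ := ih₁
    obtain ⟨g₂, hg₂, h₂⟩ := ih₂
    refine ⟨g₁ + g₂, fun j hj => by rw [Pi.add_apply, hg₁ j hj, hg₂ j hj], ?_⟩
    have heq : (∏ j, y j ^ ((g₁ + g₂) j)) * (w₁ * w₂) =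
        ((∏ j, y j ^ (g₁ j)) * w₁) * ((∏ j, y j ^ (g₂ j)) * w₂) := by
      simp only [Pi.add_apply, pow_add, Finset.prod_mul_distrib]
      ring
    rw [heq]
    exact R₁.mul_mem h₁ h₂

include hy0 in
/-- **The ideal of small elements.** In a subalgebra `A ⊆ O`, the elements smaller than every
Laurent monomial of the levels `< ℓ` of `y` form an ideal; if `A` is finitely generated, it is
generated by finitely many small elements (Hilbert's basis theorem), whence an induction
principle for the small elements of `A`. -/
theorem adValue_small_generators (A : Subalgebra k K) (hAO : A.toSubring ≤ O.toSubring)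
    (hAfg : A.FG) (ℓ : ℕ) :
    ∃ s : Finset K, (∀ g ∈ s, g ∈ A ∧ ∀ m : Fin n → ℤ, (∀ j, ℓ ≤ lv' j → m j = 0) →
      O.valuation g < ∏ j, O.valuation (y j) ^ (m j)) ∧
      ∀ (T : K → Prop), T 0 → (∀ a b, T a → T b → T (a + b)) → (∀ a z, a ∈ A → T z → T (a * z)) →
        (∀ g ∈ s, T g) →
        ∀ z ∈ A, (∀ m : Fin n → ℤ, (∀ j, ℓ ≤ lv' j → m j = 0) →
          O.valuation z < ∏ j, O.valuation (y j) ^ (m j)) → T z := by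
  classical
  have hY0 : ∀ m : Fin n → ℤ, (∏ j, O.valuation (y j) ^ (m j)) ≠ 0 := fun m =>
    Finset.prod_ne_zero_iff.mpr fun j _ => zpow_ne_zero _ ((map_ne_zero _).mpr (hy0 j))
  -- the ideal of small elements of `A`
  let P : Ideal A :=
    { carrier := {a | ∀ m : Fin n → ℤ, (∀ j, ℓ ≤ lv' j → m j = 0) →
        O.valuation (a : K) < ∏ j, O.valuation (y j) ^ (m j)}
      add_mem' := fun {a b} ha hb m hm => by
        push_cast
        exact Valuation.map_add_lt _ (ha m hm) (hb m hm)
      zero_mem' := fun m hm => by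
        push_cast
        rw [map_zero]
        exact zero_lt_iff.mpr (hY0 m)
      smul_mem' := fun c {a} ha m hm => by
        rw [smul_eq_mul]
        push_cast
        rw [map_mul]
        exact lt_of_le_of_lt (mul_le_of_le_one_left' ((O.valuation_le_one_iff _).mpr
          (hAO c.2))) (ha m hm) }
  haveI : IsNoetherianRing A := isNoetherianRing_of_fg hAfg
  obtain ⟨s, hs⟩ := (IsNoetherian.noetherian P)
  refine ⟨s.image (fun a : A => (a : K)), fun g hg => ?_, fun T hT0 hTadd hTmul hTs z hz hsmall => ?_⟩
  · obtain ⟨a, ha, rfl⟩ := Finset.mem_image.mp hg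
    have haP : a ∈ P := by rw [← hs]; exact Ideal.subset_span ha
    exact ⟨a.2, haP⟩
  · have hzP : (⟨z, hz⟩ : A) ∈ Ideal.span (s : Set A) := by
      change (⟨z, hz⟩ : A) ∈ Submodule.span A (s : Set A)
      rw [hs]
      exact hsmall
    have key : T ((⟨z, hz⟩ : A) : K) := by
      refine Submodule.span_induction
        (p := fun (a : A) (_ : a ∈ Submodule.span A (s : Set A)) => T (a : K)) ?_ ?_ ?_ ?_ hzP
      · intro a ha
        exact hTs _ (Finset.mem_image_of_mem _ ha)
      · simpa using hT0
      · intro a b _ _ ha hb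
        simpa using hTadd _ _ ha hb
      · intro c a _ ha
        simpa using hTmul _ _ c.2 ha
    exact key

end Recursion

/-- Registered anchor of this helper file: elements of `R[y]` are polynomials in `y` over `R`. -/
theorem adValue_anchor_claimC : ∀ (k K : Type) [Field k] [Field K] [Algebra k K] (n : ℕ) (R : Subalgebra k K) (y : Fin n → K) (z : K), z ∈ Algebra.adjoin k ((R : Set K) ∪ Set.range y) → ∃ P : MvPolynomial (Fin n) K, (∀ μ, P.coeff μ ∈ R) ∧ MvPolynomial.eval y P = z := by
  intro k K _ _ _ n R y z hz
  exact adValue_poly_of_mem R y hz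

end Summit.ResolutionOfSingularities.ResolutionOfSingularities.Theorems.PfaffLine

end
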